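import Literature.MathematicalPhysics.QuantumFieldTheory.LatticeGaugeAsymptotics
import Literature.MathematicalPhysics.QuantumLattice.LatticeGaugeDLRFreeEnergyProofs
import HarnessLib

/-!
# Chatterjee's free-energy asymptotics: reduction of the torus statement to the printed theorem
(`Literature.MathematicalPhysics.QuantumFieldTheory.chatterjee_freeEnergyDensity`)

Sibling proof file of `Literature/MathematicalPhysics/QuantumFieldTheory/LatticeGaugeAsymptotics.lean`
(constructive-qft.S17). The named fact `chatterjee_freeEnergyDensity` asserts, for `U(N)` Wilson
lattice gauge theory on `ℤ⁴` in the torus normalisation of the prelude (`HasFreeEnergyDensity`,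
`freeEnergyDensity` of `LatticeGaugeDLR`): (i) the free energy density per site
`f(β) = lim_L (L+1)^{-4} log Z_{(ℤ/(L+1)ℤ)^4, β}` exists for every `β`, and (ii)
`f(β) - c log β → K` as `β → ∞` for some constants `c, K`. Its source is S. Chatterjee,
*The leading term of the Yang–Mills free energy*, J. Funct. Anal. 271 (2016) 2944–3005,
arXiv:1602.01222, whose main theorem (Thm. 2.1 of the arXiv version, "Thm. 1.1" in the
docstring of the statement) is a *joint* limit `n → ∞`, `g₀ → 0` of the free energy per site of
the cubes `B_n = {0,…,n-1}^d` with *free* boundary condition; that printed theorem is vendored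
verbatim as the named fact `Literature.MathematicalPhysics.QuantumFieldTheory.chatterjee_freeEnergy`
of `Sweep1.lean`.

This file proves, sorry-free and without introducing any definition or named fact:

* `ChatterjeeFreeEnergy.tendsto_freeEnergyPerSite_halfOpenBox` — **boundary-condition
  independence of the free energy density**: for a continuous matrix representation `ρ` of a
  compact second-countable group, every `d` and every real `β`, the free-boundary free energy
  per site `F(B_n, β) = log Z(B_n, β) / n^d` of `Sweep1` (`freeEnergyPerSite ρ β (halfOpenBox d n)`,
  partition function against the infinite product Haar measure `zdHaar`) converges, as `n → ∞`,
  to the torus free energy density `freeEnergyDensity d ρ β` of `LatticeGaugeDLR`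
  (Chatterjee arXiv:1602.01222 Lemma 17.5 for the existence of the fixed-coupling cube limit;
  Friedli–Velenik 2017 Thm. 3.6 / Seiler LNP 159 Ch. 2 for the independence of the boundary
  condition). Proof: the sub-box estimate
  `QuantumLattice.FreeEnergy.abs_torusLogPartition_sub_le` of the sibling
  `LatticeGaugeDLRFreeEnergyProofs` with a single sub-box (`m = L`) compares `log Z_{Λ_L}` with
  the free partition function of the plaquettes based in `[0, L-2]^d`; the same
  plaquette-dropping bound on `ℤ^d` (`abs_log_zdPartitionFunction_sub_le`) compares the latter
  with `log Z(B_L)`; both errors are `O(L^{d-1})`.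
* `ChatterjeeFreeEnergy.tendsto_of_tendsto_prod_atTop` — the elementary filter fact turning a
  joint limit in `(n, β)` plus pointwise limits in `n` into a limit in `β`.
* `chatterjee_freeEnergyDensity_of` — **the reduction**
  `chatterjee_freeEnergy → chatterjee_freeEnergyDensity`: part (i) is the discharged prelude
  fact `QuantumLattice.exists_hasFreeEnergyDensity_holds`; for part (ii) and `N ≥ 1`, apply the
  printed theorem with `d = 4`, `G = U(N)` (`Matrix.unitaryGroup (Fin N) ℂ` with its
  fundamental representation is a unitary model, `isUnitaryModel_unitaryFundamentalRep`), pass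
  to the limit `n → ∞` at fixed `β` by the first bullet, and read off
  `f(β) + (3/2) N² log β → 3 log(∏_{j<N} j!/(2π)^{N/2}) + N² K₄`, i.e. `c = -3N²/2`; for
  `N = 0` the action vanishes identically, `Z = 1`, `f = 0` and `c = K = 0` work
  (`ChatterjeeFreeEnergy.torusLogPartition_eq_zero_of_fin_zero`).

Hence the discharge `chatterjee_freeEnergyDensity_holds` is exactly
`chatterjee_freeEnergyDensity_of h` for a proof `h` of the printed Theorem 2.1
(`chatterjee_freeEnergy`, not proved in the tree at the time of writing: its printed proof is
§§6–17 of the paper).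

## References

* S. Chatterjee, *The leading term of the Yang–Mills free energy*, J. Funct. Anal. 271 (2016)
  2944–3005, arXiv:1602.01222, §2 and Thm. 2.1 (main theorem), Lemma 17.3 and Lemma 17.5
  (comparison of cubes of different sizes, existence of the fixed-coupling limit).
* S. Friedli, Y. Velenik, *Statistical Mechanics of Lattice Systems*, CUP 2017, Ch. 3,
  Thm. 3.6 (the pressure exists and does not depend on the boundary condition).
* E. Seiler, *Gauge Theories as a Problem of Constructive Quantum Field Theory and Statistical
  Mechanics*, LNP 159 (Springer 1982), Ch. 2.
-/

noncomputable section

open MeasureTheory Filter Topology Finset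
open Literature.Probability.LatticeModels Literature.MathematicalPhysics.QuantumLattice

namespace Literature.MathematicalPhysics.QuantumFieldTheory

namespace ChatterjeeFreeEnergy

variable {d : ℕ}

/-- The box of plaquettes of `ℤ^d` based in the half-open cube `[0, n)^d`, any plane (local
notation, as in `LatticeGaugeDLRFreeEnergyProofs`). [folklore] -/
local notation3 (prettyPrint := false) "𝔅⟦" n "⟧" =>
  (halfOpenBox d n ×ˢ Finset.univ : Finset (ZdPlaquette d))

/-! ### Geometry: the plaquettes of a cube -/

/-- The plaquettes based in `[0, n)^d` have all four corners in the cube `[0, n]^d = [0, n+1)^d`,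
so (as labels `Plaq.ofZd`) they are plaquettes of `halfOpenBox d (n + 1)` in the sense of
`plaquettesIn` (Chatterjee arXiv:1602.01222 §2, the set `Λ'`). [folklore] -/
theorem image_ofZd_subset_plaquettesIn (n : ℕ) :
    (𝔅⟦n⟧).image Plaq.ofZd ⊆ plaquettesIn (halfOpenBox d (n + 1)) := by
  intro q hq
  obtain ⟨p, hp, rfl⟩ := mem_image.1 hq
  have hb : ∀ k, 0 ≤ p.1 k ∧ p.1 k < n := by simpa [mem_halfOpenBox] using hp
  have h01 : ∀ i k : Fin d, (0 : ℤ) ≤ (Pi.single i (1 : ℤ) : Fin d → ℤ) k ∧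
      (Pi.single i (1 : ℤ) : Fin d → ℤ) k ≤ 1 := fun i k => by
    by_cases hk : k = i
    · subst hk; simp
    · simp [Pi.single_eq_of_ne hk]
  rw [Plaq.mem_plaquettesIn]
  refine ⟨?_, Plaq.ofZd_lt p, ?_, ?_, ?_⟩ <;>
    simp only [Plaq.ofZd, mem_halfOpenBox, Pi.add_apply] <;> intro k <;>
    obtain ⟨h0, h1⟩ := hb k
  · exact ⟨h0, by omega⟩
  · obtain ⟨h2, h3⟩ := h01 p.2.1.1 k
    exact ⟨by omega, by omega⟩
  · obtain ⟨h2, h3⟩ := h01 p.2.1.2 k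
    exact ⟨by omega, by omega⟩
  · obtain ⟨h2, h3⟩ := h01 p.2.1.1 k
    obtain ⟨h4, h5⟩ := h01 p.2.1.2 k
    have hij : p.2.1.1 ≠ p.2.1.2 := ne_of_lt p.2.2
    have h6 : (Pi.single p.2.1.1 (1 : ℤ) : Fin d → ℤ) k +
        (Pi.single p.2.1.2 (1 : ℤ) : Fin d → ℤ) k ≤ 1 := by
      by_cases hk : k = p.2.1.1
      · subst hk
        simp [Pi.single_eq_of_ne hij]
      · simp only [Pi.single_eq_of_ne hk, zero_add]
        exact h5
    exact ⟨by omega, by omega⟩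

/-- Every plaquette of a region is a genuine plaquette based in the region, so
`#(plaquettesIn Λ_n) ≤ n^d · #planes` for the cube `Λ_n = [0, n)^d`. [folklore] -/
theorem card_plaquettesIn_halfOpenBox_le (n : ℕ) :
    #(plaquettesIn (halfOpenBox d n)) ≤ n ^ d * Fintype.card {q : Fin d × Fin d // q.1 < q.2} := by
  calc #(plaquettesIn (halfOpenBox d n))
      ≤ #((𝔅⟦n⟧).image Plaq.ofZd) := card_le_card fun q hq => ?_
    _ ≤ #𝔅⟦n⟧ := card_image_le
    _ = n ^ d * Fintype.card {q : Fin d × Fin d // q.1 < q.2} := FreeEnergy.card_boxPlaqs n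
  obtain ⟨h1, h2, -⟩ := Plaq.mem_plaquettesIn.1 hq
  exact mem_image.2 ⟨(q.1, ⟨(q.2.1, q.2.2), h2⟩), mem_product.2 ⟨h1, mem_univ _⟩, rfl⟩

/-! ### Free-boundary partition functions of cubes versus boxes of plaquettes -/

variable {N : ℕ} {G : Type*} [Group G] [TopologicalSpace G] [IsTopologicalGroup G]
  [CompactSpace G] [MeasurableSpace G] [BorelSpace G] (ρ : G →* Matrix (Fin N) (Fin N) ℂ)

/-- The Boltzmann weight `exp(-β (N - Re tr ρ(U_p)))` of one genuine plaquette of `ℤ^d` (local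
notation, as in `LatticeGaugeDLRFreeEnergyProofs`). [folklore] -/
local notation3 (prettyPrint := false) "𝔴⟦" β ", " p ", " U "⟧" =>
  Real.exp (-β * ((N : ℝ) - plaquetteObs ρ (Prod.fst p) (Prod.snd p).1.1 (Prod.snd p).1.2 U))

/-- The free-boundary partition function `Z(A) = ∫ ∏_{p ∈ A} exp(-β (N - Re tr ρ(U_p))) dg_∞`
of a finite set of genuine plaquettes (local notation, as in `LatticeGaugeDLRFreeEnergyProofs`).
[folklore] -/
local notation3 (prettyPrint := false) "ℨ⟦" β ", " A "⟧" =>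
  ∫ U, ∏ p ∈ A, 𝔴⟦β, p, U⟧ ∂zdHaar d G

/-- The Boltzmann weight of a plaquette *label* `q = (x, i, j)` (`Sweep1`'s `plaquettesIn`
elements), `exp(-β (N - Re tr ρ(U_q)))` (local notation). [folklore] -/
local notation3 (prettyPrint := false) "𝔳⟦" β ", " q ", " U "⟧" =>
  Real.exp (-β * ((N : ℝ) -
    (ρ (ZdGaugeConfig.plaquette U (Prod.fst q) (Prod.snd q).1 (Prod.snd q).2)).trace.re))

omit [TopologicalSpace G] [IsTopologicalGroup G] [CompactSpace G] [MeasurableSpace G]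
  [BorelSpace G] in
/-- `exp(-β S_Λ(U)) = ∏_{q ∈ Λ'} exp(-β (N - Re tr ρ(U_q)))`. [folklore] -/
theorem exp_neg_mul_zdWilsonAction (β : ℝ) (Λ : Finset (Literature.Probability.LatticeModels.Site d))
    (U : ZdGaugeConfig d G) :
    Real.exp (-β * zdWilsonAction ρ Λ U) = ∏ q ∈ plaquettesIn Λ, 𝔳⟦β, q, U⟧ := by
  unfold zdWilsonAction
  rw [Finset.mul_sum, Real.exp_sum]

omit [TopologicalSpace G] [IsTopologicalGroup G] [CompactSpace G] [MeasurableSpace G]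
  [BorelSpace G] in
/-- The label weight of a genuine plaquette is its plaquette weight. [folklore] -/
theorem labelWeight_ofZd (β : ℝ) (p : ZdPlaquette d) (U : ZdGaugeConfig d G) :
    𝔳⟦β, Plaq.ofZd p, U⟧ = 𝔴⟦β, p, U⟧ := rfl

omit [TopologicalSpace G] [IsTopologicalGroup G] [CompactSpace G] [MeasurableSpace G]
  [BorelSpace G] in
/-- The weight of the image of a set of genuine plaquettes is its box weight. [folklore] -/
theorem prod_image_ofZd (β : ℝ) (A : Finset (ZdPlaquette d)) (U : ZdGaugeConfig d G) :
    ∏ q ∈ A.image Plaq.ofZd, 𝔳⟦β, q, U⟧ = ∏ p ∈ A, 𝔴⟦β, p, U⟧ :=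
  (prod_image fun _ _ _ _ h => Plaq.ofZd_injective h).trans
    (prod_congr rfl fun p _ => labelWeight_ofZd ρ β p U)

omit [CompactSpace G] [MeasurableSpace G] [BorelSpace G] in
/-- The label weights are continuous for continuous `ρ`. [folklore] -/
theorem continuous_labelWeight (hρ : Continuous ρ) (β : ℝ) (Q : Finset (Plaq d)) :
    Continuous fun U : ZdGaugeConfig d G => ∏ q ∈ Q, 𝔳⟦β, q, U⟧ := by
  refine continuous_finsetProd _ fun q _ => ?_
  have h1 : Continuous fun U : ZdGaugeConfig d G =>
      (ρ (ZdGaugeConfig.plaquette U q.1 q.2.1 q.2.2)).trace.re :=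
    Complex.continuous_re.comp (hρ.comp (AreaLaw.continuous_plaquette q.1 q.2.1 q.2.2)).matrix_trace
  exact Real.continuous_exp.comp (continuous_const.mul (continuous_const.sub h1))

variable [SecondCountableTopology G]

/-- The free-boundary partition function of `Sweep1` as a Bochner integral of the label weights:
`Z_{Λ,β} = ∫ ∏_{q ∈ Λ'} exp(-β (N - Re tr ρ(U_q))) dg_∞`. [folklore] -/
theorem zdPartitionFunction_eq_ofReal (hρ : Continuous ρ) (β : ℝ)
    (Λ : Finset (Literature.Probability.LatticeModels.Site d)) :
    zdPartitionFunction ρ β Λ =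
      ENNReal.ofReal (∫ U, ∏ q ∈ plaquettesIn Λ, 𝔳⟦β, q, U⟧ ∂zdHaar d G) := by
  unfold zdPartitionFunction zdWilsonWeight
  rw [withDensity_apply _ MeasurableSet.univ, Measure.restrict_univ]
  simp_rw [exp_neg_mul_zdWilsonAction]
  rw [ofReal_integral_eq_lintegral_ofReal
    (AreaLaw.integrable_zdHaar_of_continuous (continuous_labelWeight ρ hρ β _))
    (ae_of_all _ fun U => prod_nonneg fun _ _ => (Real.exp_pos _).le)]

/-- **Dropping boundary plaquettes on `ℤ^d`** (Chatterjee arXiv:1602.01222, proof of Lemma 17.5: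
dropping a plaquette changes `log Z` by at most a constant times `β`). The free-boundary
partition function of the cube `[0, n]^d` and the partition function of the plaquettes based in
`[0, n)^d` (a subset of its plaquettes, of the same cardinality up to a surface term) satisfy
`|log Z(B_{n+1}) - log Z(A_n)| ≤ |β| (N + M) · #planes · ((n+1)^d - n^d)`, where
`|Re tr ρ| ≤ M`. [cite: arXiv160201222, §17, proof of Lemma 17.5] -/
theorem abs_log_zdPartitionFunction_sub_le (hρ : Continuous ρ) {M : ℝ}
    (hM : ∀ g, |(ρ g).trace.re| ≤ M) (β : ℝ) (n : ℕ) :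
    |Real.log (zdPartitionFunction ρ β (halfOpenBox d (n + 1))).toReal - Real.log ℨ⟦β, 𝔅⟦n⟧⟧| ≤
      |β| * (N + M) * (Fintype.card {q : Fin d × Fin d // q.1 < q.2} *
        (((n + 1 : ℕ) : ℝ) ^ d - (n : ℝ) ^ d)) := by
  set D : ℕ := Fintype.card {q : Fin d × Fin d // q.1 < q.2} with hD
  set K : ℝ := |β| * (N + M) with hK
  set A : Finset (ZdPlaquette d) := 𝔅⟦n⟧ with hA
  set Q : Finset (Plaq d) := plaquettesIn (halfOpenBox d (n + 1)) with hQ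
  set A' : Finset (Plaq d) := A.image Plaq.ofZd with hA'
  have hsub : A' ⊆ Q := image_ofZd_subset_plaquettesIn n
  have hM0 : 0 ≤ M := (abs_nonneg _).trans (hM 1)
  have hK0 : 0 ≤ K := mul_nonneg (abs_nonneg β) (add_nonneg (Nat.cast_nonneg N) hM0)
  -- cardinalities
  have hcardA' : #A' = n ^ d * D := by
    rw [hA', card_image_of_injective _ Plaq.ofZd_injective, hA, FreeEnergy.card_boxPlaqs]
  have hcardQ : #Q ≤ (n + 1) ^ d * D := card_plaquettesIn_halfOpenBox_le (n + 1)
  have hcard : (#(Q \ A') : ℝ) ≤ D * (((n + 1 : ℕ) : ℝ) ^ d - (n : ℝ) ^ d) := by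
    have h := card_sdiff_add_card_eq_card hsub
    have h' : #(Q \ A') + n ^ d * D ≤ (n + 1) ^ d * D := by rw [← hcardA', h]; exact hcardQ
    have h'' : (#(Q \ A') : ℝ) + (n : ℝ) ^ d * D ≤ ((n + 1 : ℕ) : ℝ) ^ d * D := by
      exact_mod_cast h'
    linarith
  -- pointwise two-sided bounds for the dropped weights
  have hfac : ∀ U : ZdGaugeConfig d G,
      ∏ q ∈ Q, 𝔳⟦β, q, U⟧ = (∏ q ∈ Q \ A', 𝔳⟦β, q, U⟧) * ∏ p ∈ A, 𝔴⟦β, p, U⟧ := fun U => by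
    rw [← prod_sdiff hsub, hA', prod_image_ofZd]
  have hup : ∀ U : ZdGaugeConfig d G,
      ∏ q ∈ Q, 𝔳⟦β, q, U⟧ ≤ Real.exp K ^ #(Q \ A') * ∏ p ∈ A, 𝔴⟦β, p, U⟧ := fun U => by
    rw [hfac]
    refine mul_le_mul_of_nonneg_right ?_ (prod_nonneg fun p _ => (Real.exp_pos _).le)
    rw [← prod_const]
    exact prod_le_prod (fun p _ => (Real.exp_pos _).le) fun p _ =>
      Real.exp_le_exp.2 (abs_le.1 (FreeEnergy.abs_mul_cost_le ρ hM β _)).2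
  have hlow : ∀ U : ZdGaugeConfig d G,
      Real.exp (-K) ^ #(Q \ A') * ∏ p ∈ A, 𝔴⟦β, p, U⟧ ≤ ∏ q ∈ Q, 𝔳⟦β, q, U⟧ := fun U => by
    rw [hfac]
    refine mul_le_mul_of_nonneg_right ?_ (prod_nonneg fun p _ => (Real.exp_pos _).le)
    rw [← prod_const]
    exact prod_le_prod (fun p _ => (Real.exp_pos _).le) fun p _ =>
      Real.exp_le_exp.2 (abs_le.1 (FreeEnergy.abs_mul_cost_le ρ hM β _)).1
  -- integrate
  set T : ℝ := ∫ U, ∏ q ∈ Q, 𝔳⟦β, q, U⟧ ∂zdHaar d G with hT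
  set z : ℝ := ℨ⟦β, A⟧ with hz
  have hz0 : 0 < z := FreeEnergy.zdZ_pos ρ hρ β A
  have hiQ : Integrable (fun U : ZdGaugeConfig d G => ∏ q ∈ Q, 𝔳⟦β, q, U⟧) (zdHaar d G) :=
    AreaLaw.integrable_zdHaar_of_continuous (continuous_labelWeight ρ hρ β Q)
  have hiA : Integrable (fun U : ZdGaugeConfig d G => ∏ p ∈ A, 𝔴⟦β, p, U⟧) (zdHaar d G) :=
    FreeEnergy.integrable_boxWeight ρ hρ β A
  have hTup : T ≤ Real.exp K ^ #(Q \ A') * z := by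
    rw [hT, hz, ← integral_const_mul]
    exact integral_mono hiQ (hiA.const_mul _) hup
  have hTlow : Real.exp (-K) ^ #(Q \ A') * z ≤ T := by
    rw [hT, hz, ← integral_const_mul]
    exact integral_mono (hiA.const_mul _) hiQ hlow
  have hT0 : 0 < T := lt_of_lt_of_le (mul_pos (pow_pos (Real.exp_pos _) _) hz0) hTlow
  -- logarithms
  have hlogZ : Real.log (zdPartitionFunction ρ β (halfOpenBox d (n + 1))).toReal = Real.log T := by
    rw [zdPartitionFunction_eq_ofReal ρ hρ β, ← hT, ENNReal.toReal_ofReal hT0.le]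
  have h1 : Real.log T ≤ #(Q \ A') * K + Real.log z := by
    have := Real.log_le_log hT0 hTup
    rwa [Real.log_mul (pow_pos (Real.exp_pos _) _).ne' hz0.ne', Real.log_pow, Real.log_exp] at this
  have h2 : #(Q \ A') * (-K) + Real.log z ≤ Real.log T := by
    have := Real.log_le_log (mul_pos (pow_pos (Real.exp_pos _) _) hz0) hTlow
    rwa [Real.log_mul (pow_pos (Real.exp_pos _) _).ne' hz0.ne', Real.log_pow, Real.log_exp] at this
  have hcK : (#(Q \ A') : ℝ) * K ≤ K * (D * (((n + 1 : ℕ) : ℝ) ^ d - (n : ℝ) ^ d)) := by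
    rw [mul_comm]
    exact mul_le_mul_of_nonneg_left hcard hK0
  rw [hlogZ, abs_le]
  constructor <;> linarith

/-- **The torus versus one free cube** (the case `m = L` of the sub-box estimate
`QuantumLattice.FreeEnergy.abs_torusLogPartition_sub_le`; Friedli–Velenik 2017, proof of
Thm. 3.6, "comparing `Z^∅` and `Z^{per}`"): `|log Z_{Λ_{n+1}} - log Z(A_n)| ≤
|β| (N + M) · #planes · ((n+1)^d - n^d)`. [cite: FriedliVelenik2017, Ch. 3 §3.2.2, proof of Thm. 3.6] -/
theorem abs_torusLogPartition_sub_log_le (hρ : Continuous ρ) {M : ℝ}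
    (hM : ∀ g, |(ρ g).trace.re| ≤ M) (β : ℝ) (n : ℕ) :
    |torusLogPartition d ρ β (n + 1) - Real.log ℨ⟦β, 𝔅⟦n⟧⟧| ≤
      |β| * (N + M) * (Fintype.card {q : Fin d × Fin d // q.1 < q.2} *
        (((n + 1 : ℕ) : ℝ) ^ d - (n : ℝ) ^ d)) := by
  have h := FreeEnergy.abs_torusLogPartition_sub_le (d := d) ρ hρ hM β (n + 1) (n + 1)
    (Nat.succ_le_succ (Nat.zero_le n))
  have hdiv : (n + 1) / (n + 1) = 1 := Nat.div_self n.succ_pos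
  simp only [hdiv, one_pow, Nat.cast_one, one_mul, Nat.add_sub_cancel] at h
  exact h

/-- **Free and periodic free energies per site agree asymptotically**:
`|F(B_{n+1}, β) - (n+1)^{-d} log Z_{Λ_{n+1}, β}| ≤ 2 |β| (N + M) #planes (1 - (n/(n+1))^d)`.
[cite: FriedliVelenik2017, Ch. 3 §3.2.2, Thm. 3.6 (independence of the boundary condition)] -/
theorem abs_freeEnergyPerSite_sub_le (hρ : Continuous ρ) {M : ℝ}
    (hM : ∀ g, |(ρ g).trace.re| ≤ M) (β : ℝ) (n : ℕ) :
    |freeEnergyPerSite ρ β (halfOpenBox d (n + 1)) -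
        (((n + 1 : ℕ) : ℝ) ^ d)⁻¹ * torusLogPartition d ρ β (n + 1)| ≤
      2 * (|β| * (N + M)) * Fintype.card {q : Fin d × Fin d // q.1 < q.2} *
        (1 - ((n : ℝ) / ((n + 1 : ℕ) : ℝ)) ^ d) := by
  set D : ℕ := Fintype.card {q : Fin d × Fin d // q.1 < q.2}
  set K : ℝ := |β| * (N + M)
  set s : ℝ := ((n + 1 : ℕ) : ℝ) ^ d with hs
  have hs0 : 0 < s := by positivity
  have hs1 : s ≠ 0 := hs0.ne'
  set X : ℝ := Real.log (zdPartitionFunction ρ β (halfOpenBox d (n + 1))).toReal with hX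
  set Y : ℝ := torusLogPartition d ρ β (n + 1)
  set z : ℝ := Real.log ℨ⟦β, 𝔅⟦n⟧⟧
  have h1 : |X - z| ≤ K * (D * (s - (n : ℝ) ^ d)) := abs_log_zdPartitionFunction_sub_le ρ hρ hM β n
  have h2 : |Y - z| ≤ K * (D * (s - (n : ℝ) ^ d)) := abs_torusLogPartition_sub_log_le ρ hρ hM β n
  have hF : freeEnergyPerSite ρ β (halfOpenBox d (n + 1)) = s⁻¹ * X := by
    simp only [hX, hs, freeEnergyPerSite, card_halfOpenBox, Nat.cast_pow, div_eq_inv_mul]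
  rw [hF, ← mul_sub, abs_mul, abs_of_pos (inv_pos.2 hs0)]
  have hXY : |X - Y| ≤ 2 * K * (D * (s - (n : ℝ) ^ d)) := by
    calc |X - Y| = |(X - z) - (Y - z)| := by ring_nf
      _ ≤ |X - z| + |Y - z| := abs_sub _ _
      _ ≤ 2 * K * (D * (s - (n : ℝ) ^ d)) := by linarith
  have hss : s⁻¹ * s = 1 := inv_mul_cancel₀ hs1
  have hratio : s⁻¹ * (2 * K * (D * (s - (n : ℝ) ^ d))) =
      2 * K * D * (1 - ((n : ℝ) / ((n + 1 : ℕ) : ℝ)) ^ d) := by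
    rw [div_pow, ← hs, div_eq_mul_inv]
    linear_combination (2 * K * D) * hss
  calc s⁻¹ * |X - Y| ≤ s⁻¹ * (2 * K * (D * (s - (n : ℝ) ^ d))) :=
        mul_le_mul_of_nonneg_left hXY (inv_pos.2 hs0).le
    _ = 2 * K * D * (1 - ((n : ℝ) / ((n + 1 : ℕ) : ℝ)) ^ d) := hratio

/-- **Boundary-condition independence of the free energy density** (Chatterjee
arXiv:1602.01222 Lemma 17.5 for the existence of the free-boundary cube limit at fixed coupling;
Friedli–Velenik 2017 Thm. 3.6 and Seiler LNP 159 Ch. 2 for its coincidence with the periodic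
one). For a continuous matrix representation `ρ` of a compact second-countable group `G`, every
dimension `d` and every real `β`, the free energy per site `F(B_n, β) = log Z(B_n, β)/n^d` of
the cubes `B_n = {0,…,n-1}^d` with free boundary condition (`Sweep1`'s `freeEnergyPerSite`, the
quantity of Chatterjee's Theorem 2.1) converges as `n → ∞` to the torus free energy density
`freeEnergyDensity d ρ β` of `LatticeGaugeDLR`. [cite: arXiv160201222, §17 Lemma 17.5; FriedliVelenik2017, Ch. 3 Thm. 3.6] -/
theorem tendsto_freeEnergyPerSite_halfOpenBox (hρ : Continuous ρ) (β : ℝ) :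
    Tendsto (fun n : ℕ => freeEnergyPerSite ρ β (halfOpenBox d n)) atTop
      (𝓝 (freeEnergyDensity d ρ β)) := by
  obtain ⟨M, -, hM⟩ := exists_bound_trace_re_nonneg ρ hρ
  have hf : HasFreeEnergyDensity d ρ β (freeEnergyDensity d ρ β) :=
    hasFreeEnergyDensity_freeEnergyDensity ρ (exists_hasFreeEnergyDensity_holds (d := d) ρ hρ β)
  -- the bound of `abs_freeEnergyPerSite_sub_le` tends to `0`
  have hb : Tendsto (fun n : ℕ => 2 * (|β| * (N + M)) *
      (Fintype.card {q : Fin d × Fin d // q.1 < q.2} : ℝ) * (1 - ((n : ℝ) / ((n + 1 : ℕ) : ℝ)) ^ d))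
      atTop (𝓝 (2 * (|β| * (N + M)) * (Fintype.card {q : Fin d × Fin d // q.1 < q.2} : ℝ) *
        (1 - 1 ^ d))) := by
    refine (tendsto_const_nhds.sub (Tendsto.pow ?_ d)).const_mul _
    exact (tendsto_natCast_div_add_atTop (1 : ℝ)).congr fun n => by rw [Nat.cast_succ]
  rw [one_pow, sub_self, mul_zero] at hb
  have hdiff : Tendsto (fun n : ℕ => freeEnergyPerSite ρ β (halfOpenBox d (n + 1)) -
      (((n + 1 : ℕ) : ℝ) ^ d)⁻¹ * torusLogPartition d ρ β (n + 1)) atTop (𝓝 0) :=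
    squeeze_zero_norm (fun n => by
      rw [Real.norm_eq_abs]; exact abs_freeEnergyPerSite_sub_le ρ hρ hM β n) hb
  have h := hdiff.add hf
  rw [zero_add] at h
  refine (tendsto_add_atTop_iff_nat (f := fun n : ℕ => freeEnergyPerSite ρ β (halfOpenBox d n))
    1).1 (h.congr fun n => ?_)
  simp only [sub_add_cancel]

/-! ### From the joint limit to the limit in `β` -/

/-- An elementary filter fact: if `Φ(n, β) → K` as `n → ∞` and `β → ∞` *jointly*
(`atTop ×ˢ atTop`), and for every `β` the limit `Ψ(β) = lim_n Φ(n, β)` exists, then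
`Ψ(β) → K` as `β → ∞`. [folklore] -/
theorem tendsto_of_tendsto_prod_atTop {Φ : ℕ × ℝ → ℝ} {Ψ : ℝ → ℝ} {K : ℝ}
    (hΦ : Tendsto Φ (atTop ×ˢ atTop) (𝓝 K))
    (hΨ : ∀ β, Tendsto (fun n : ℕ => Φ (n, β)) atTop (𝓝 (Ψ β))) :
    Tendsto Ψ atTop (𝓝 K) := by
  rw [Metric.tendsto_atTop]
  intro ε hε
  have h := Metric.tendsto_nhds.1 hΦ (ε / 2) (half_pos hε)
  rw [prod_atTop_atTop_eq, eventually_atTop] at h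
  obtain ⟨⟨n₀, β₀⟩, h⟩ := h
  refine ⟨β₀, fun β hβ => ?_⟩
  have hev : ∀ᶠ n : ℕ in atTop, dist (Φ (n, β)) K ≤ ε / 2 :=
    eventually_atTop.2 ⟨n₀, fun n hn => (h (n, β) ⟨hn, hβ⟩).le⟩
  have hle : dist (Ψ β) K ≤ ε / 2 :=
    le_of_tendsto ((hΨ β).dist tendsto_const_nhds) hev
  linarith

/-- Chatterjee's finite-size coefficient `a (m - 1 - m/n + n^{-m}) b` tends to `a (m - 1) b`
(for `m ≥ 1`). [folklore] -/
theorem tendsto_coeff {m : ℕ} (hm : 1 ≤ m) (a b : ℝ) :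
    Tendsto (fun n : ℕ => a * ((m : ℝ) - 1 - m / n + 1 / (n : ℝ) ^ m) * b) atTop
      (𝓝 (a * ((m : ℝ) - 1) * b)) := by
  have h1 : Tendsto (fun n : ℕ => (m : ℝ) / n) atTop (𝓝 0) :=
    tendsto_const_div_atTop_nhds_zero_nat (m : ℝ)
  have h2 : Tendsto (fun n : ℕ => 1 / (n : ℝ) ^ m) atTop (𝓝 0) := by
    have h := tendsto_inv_atTop_zero.comp
      ((tendsto_pow_atTop (Nat.one_le_iff_ne_zero.1 hm)).comp (tendsto_natCast_atTop_atTop (R := ℝ)))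
    refine h.congr fun n => ?_
    simp [Function.comp]
  have h3 : Tendsto (fun n : ℕ => (m : ℝ) - 1 - m / n + 1 / (n : ℝ) ^ m) atTop
      (𝓝 ((m : ℝ) - 1 - 0 + 0)) :=
    (tendsto_const_nhds.sub h1).add h2
  rw [sub_zero, add_zero] at h3
  exact (h3.const_mul a).mul_const b

/-! ### The degenerate case `N = 0` -/

/-- For `N = 0` every plaquette cost `N - Re tr ρ(U_p)` vanishes (the trace of a `0 × 0`
matrix is `0`), so the torus partition function is `1` and `log Z = 0`. [folklore] -/
theorem torusLogPartition_eq_zero_of_fin_zero (ρ₀ : G →* Matrix (Fin 0) (Fin 0) ℂ)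
    (hρ : Continuous ρ₀) (β : ℝ) (L : ℕ) [NeZero L] :
    torusLogPartition d ρ₀ β L = 0 := by
  rw [torusLogPartition, FreeEnergy.partitionFunction_eq_ofReal_integral ρ₀ hρ β]
  have h : ∀ (U : GaugeConfig d L G) (p : Plaquette d L), plaquetteCost ρ₀ U p = 0 := fun U p => by
    simp [plaquetteCost, Matrix.trace]
  simp [h]

/-- For `N = 0` the torus free energy density is `0` at every `β`. [folklore] -/
theorem hasFreeEnergyDensity_zero_of_fin_zero (ρ₀ : G →* Matrix (Fin 0) (Fin 0) ℂ)
    (hρ : Continuous ρ₀) (β : ℝ) : HasFreeEnergyDensity d ρ₀ β 0 := by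
  unfold HasFreeEnergyDensity
  refine tendsto_const_nhds.congr fun L => ?_
  rw [torusLogPartition_eq_zero_of_fin_zero ρ₀ hρ β (L + 1), mul_zero]

end ChatterjeeFreeEnergy

/-! ### `U(N)` is a unitary model -/

/-- `G = U(N)` with its fundamental representation is a unitary model in the sense of `Sweep1`
(`IsUnitaryModel`: continuous, faithful, with range exactly the unitary group). [folklore] -/
theorem isUnitaryModel_unitaryFundamentalRep (N : ℕ) :
    IsUnitaryModel (unitaryFundamentalRep (Fin N) ℂ) := by
  refine ⟨continuous_unitaryFundamentalRep (Fin N) ℂ, unitaryFundamentalRep_injective (Fin N) ℂ,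
    Set.ext fun M => ⟨?_, fun hM => ⟨⟨M, hM⟩, rfl⟩⟩⟩
  rintro ⟨U, rfl⟩
  exact U.2

/-! ### The reduction -/

/-- **Chatterjee's torus free-energy asymptotics from the printed Theorem 2.1.** The named fact
`chatterjee_freeEnergyDensity` (constructive-qft.S17 in the torus normalisation of the prelude)
follows from the printed joint-limit theorem on free-boundary cubes
`chatterjee_freeEnergy` (`Sweep1`; S. Chatterjee, J. Funct. Anal. 271 (2016), arXiv:1602.01222,
Thm. 2.1):

* part (i), existence of `f(β) = lim_L (L+1)^{-4} log Z_{(ℤ/(L+1)ℤ)^4, β}` for every real `β`,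
  is the discharged prelude fact `QuantumLattice.exists_hasFreeEnergyDensity_holds`
  (`U(N)` is compact second countable, the fundamental representation is continuous);
* part (ii) for `N ≥ 1`: by Theorem 2.1 with `d = 4`, `G = U(N)`
  (`isUnitaryModel_unitaryFundamentalRep`),
  `F(B_n, β) + ½ (3 - 4/n + n^{-4}) N² log β → K' := 3 log(∏_{j<N} j!/(2π)^{N/2}) + N² K₄`
  jointly in `(n, β)`; at fixed `β`, `F(B_n, β) → f(β)`
  (`ChatterjeeFreeEnergy.tendsto_freeEnergyPerSite_halfOpenBox`: the free-boundary cube free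
  energy density equals the torus one) and the coefficient tends to `3/2`, so
  `f(β) + (3/2) N² log β → K'` as `β → ∞`
  (`ChatterjeeFreeEnergy.tendsto_of_tendsto_prod_atTop`), i.e. (ii) with `c = -3N²/2`,
  `K = K'` — the constants quoted in the docstring of the statement;
* part (ii) for `N = 0`: the Wilson action of `U(0)` vanishes, `Z = 1`, `f = 0`, and
  `c = K = 0` (`ChatterjeeFreeEnergy.hasFreeEnergyDensity_zero_of_fin_zero`).
[cite: arXiv160201222, Thm. 2.1 and §17 (Lemmas 17.3, 17.5: fixed-coupling limits of the cube free energy)] -/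
theorem chatterjee_freeEnergyDensity_of (h : chatterjee_freeEnergy) :
    chatterjee_freeEnergyDensity := by
  intro N
  -- `U(N) ⊆ M_N(ℂ)` is second countable (the `Matrix` synonym hides the `Pi` instance)
  haveI : SecondCountableTopology (Matrix (Fin N) (Fin N) ℂ) :=
    inferInstanceAs (SecondCountableTopology (Fin N → Fin N → ℂ))
  haveI : SecondCountableTopology (Matrix.unitaryGroup (Fin N) ℂ) :=
    Topology.IsEmbedding.subtypeVal.secondCountableTopology
  have hρ : Continuous (unitaryFundamentalRep (Fin N) ℂ) :=
    continuous_unitaryFundamentalRep (Fin N) ℂ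
  have hi : ∀ β : ℝ, HasFreeEnergyDensity 4 (unitaryFundamentalRep (Fin N) ℂ) β
      (freeEnergyDensity 4 (unitaryFundamentalRep (Fin N) ℂ) β) := fun β =>
    hasFreeEnergyDensity_freeEnergyDensity _
      (exists_hasFreeEnergyDensity_holds (d := 4) (unitaryFundamentalRep (Fin N) ℂ) hρ β)
  refine ⟨hi, ?_⟩
  rcases Nat.eq_zero_or_pos N with hN | hN
  · -- `N = 0`: everything vanishes
    subst hN
    refine ⟨0, 0, ?_⟩
    have h0 : ∀ β : ℝ, freeEnergyDensity 4 (unitaryFundamentalRep (Fin 0) ℂ) β = 0 := fun β =>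
      (ChatterjeeFreeEnergy.hasFreeEnergyDensity_zero_of_fin_zero (d := 4) _ hρ β).freeEnergyDensity_eq
    simp only [h0, zero_mul, sub_zero]
    exact tendsto_const_nhds
  · -- `N ≥ 1`: Chatterjee's Theorem 2.1 with `d = 4`, `G = U(N)`
    obtain ⟨K, hK⟩ := h 4 (by norm_num)
    have hjoint := hK N (Nat.one_le_of_lt hN) _ (unitaryFundamentalRep (Fin N) ℂ)
      (isUnitaryModel_unitaryFundamentalRep N)
    refine ⟨-(3 / 2 * (N : ℝ) ^ 2), _,
      ChatterjeeFreeEnergy.tendsto_of_tendsto_prod_atTop hjoint fun β => ?_⟩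
    have h1 := ChatterjeeFreeEnergy.tendsto_freeEnergyPerSite_halfOpenBox (d := 4)
      (unitaryFundamentalRep (Fin N) ℂ) hρ β
    have h2 := ChatterjeeFreeEnergy.tendsto_coeff (m := 4) (by norm_num) (1 / 2 : ℝ)
      ((N : ℝ) ^ 2 * Real.log β)
    have h3 := h1.add h2
    have hlim : freeEnergyDensity 4 (unitaryFundamentalRep (Fin N) ℂ) β +
        (1 / 2 : ℝ) * (((4 : ℕ) : ℝ) - 1) * ((N : ℝ) ^ 2 * Real.log β) =
        freeEnergyDensity 4 (unitaryFundamentalRep (Fin N) ℂ) β -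
          -(3 / 2 * (N : ℝ) ^ 2) * Real.log β := by
      push_cast
      ring
    rw [hlim] at h3
    refine h3.congr fun n => ?_
    simp only [mul_assoc]

end Literature.MathematicalPhysics.QuantumFieldTheory
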